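import Literature.MathematicalPhysics.QuantumLattice.XYOrderIntegralProofs
import HarnessLib

/-!
# Björnberg–Ueltschi, spin-½ planar window: the sharper bound on the KLS lattice integral `Ĩ⁽²⁾`

Topic `MathematicalPhysics/QuantumLattice`; first sibling proof file of `XYZGroundStateOrder.lean`
(named fact `bjornbergUeltschi2022_ground_lro_spinHalf`, item
`provefact-Literature.MathematicalPhysics.QuantumLa-089185f5fb`). No statement of the tree is
changed and no named fact is introduced.

The numerical input of Björnberg–Ueltschi's Theorem 3.2 in the ground state of the planar spin-½
model is the integral `Ĩ⁽²⁾ = (2π)⁻² ∫_{[-π,π]²} √(ε(k+π)/ε(k)) (½ Σᵢ cos kᵢ)₊ dk = 0.6468` (Table 1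
of [BjornbergUeltschi2022], eq. (3.7)), which is *the same* integral as Kennedy–Lieb–Shastry's
`I(2)` — the tree's `klsIntegral 2` (`XYOrderProofs.lean`). The tree proves only the analytic
majorant `I(2) ≤ 3√2/(2π) = 0.6752…` (`lintegral_klsIntegrand_two_le`, `klsIntegral_two_le_holds`),
which suffices for the XY model but not for the anisotropic window, where the second lower bound of
[BjornbergUeltschi2022, Thm. 3.2] is positive at `-J⁽²⁾/J⁽¹⁾ = 0.109` only if `Ĩ⁽²⁾ < 0.6538…`
(see the sibling `XYZGroundStateOrderProofs.lean` for the assembly). This file sharpens the majorant to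

  `∫_{[-π,π]²} F₂ ≤ 15√2π²/16 + 4π`, i.e. `Ĩ⁽²⁾ = I(2) ≤ 15√2/64 + 1/π = 0.64976…`
  (`lintegral_klsIntegrand_two_le_sharp`),

and feeds it through the tree's monotone-cell comparison of the punctured Riemann sums with the
integral (`kls_cell_spec`, `kls_cell_disjoint`, `kls_boundary_sum_le` of `XYOrderIntegralProofs.lean`)
to get `R_L(2) ≤ 15√2/64 + 1/π + 2√2(1 + log L)/L` (`klsRiemannSum_two_le_sharp`) and
`R_L(2) ≤ 0.651` for all large `L` (`klsRiemannSum_two_eventually_le`).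

## The sharper majorant

After the half-angle substitution `s = sin(a/2)`, `t = sin(b/2)` of the tree (`x = ½(cos a + cos b)
= 1 - s² - t²`, `da db = 4 ds dt/√((1-s²)(1-t²))`), the integrand on the unit disc `r² = s² + t² < 1`
is `4(1-r²)√((2-r²)/r²) / √((1-s²)(1-t²))`. The tree bounds `(1-s²)(1-t²) ≥ 1 - r²`, which discards
the angular dependence. Here instead: `(1-s²)(1-t²) = 1 - r² + s²t²` is, for fixed `r`, the convex
combination `w₁(1-r²) + w₂(1-r²/2)²` with `w₂ = 4s²t²/r⁴ = sin²2φ`, `w₁ = cos²2φ`, and `X ↦ X^{-1/2}`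
is convex, so (`inv_sqrt_convexComb_le`)

  `1/√((1-s²)(1-t²)) ≤ cos²(2φ)/√(1-r²) + sin²(2φ)/(1 - r²/2)`

(the chord; integrated over the angle this is the arithmetic-mean relaxation `½(1/a + 1/b)` of the
exact value `1/M(a,b) ≤ 1/√(ab)`, `a = √(1-r²)`, `b = 1 - r²/2`, `M` the arithmetic–geometric mean).
With `∫_{-π}^{π} cos²2φ = ∫ sin²2φ = π`, the radial integrals are
`R_b = ∫₀¹ 8(1-r²)/√(2-r²) dr = 4` exactly (`d/dr [4r√(2-r²)] = 8(1-r²)/√(2-r²)`), and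
`R_a = ∫₀¹ 4√((1-r²)(2-r²)) dr ≤ 4√2 ∫₀¹ √(1-r²)(1 - r²/4) dr = 15√2π/16` (`√(2-r²) ≤ √2(1-r²/4)`;
`∫₀¹ √(1-r²) = π/4`, and `∫₀¹ √(1-r²)(1-4r²) = 0` from `d/dr [r(1-r²)√(1-r²)] = √(1-r²)(1-4r²)`).
Numerically: true value `0.64680`, this bound `0.64977`, needed `< 0.65389`.

## References

* [BjornbergUeltschi2022] J. E. Björnberg, D. Ueltschi, *Reflection positivity and infrared bounds
  for quantum spin systems*, in: The Physics and Mathematics of Elliott Lieb, vol. I, EMS Press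
  (2022) 77–108, eqs. (3.6)–(3.7) and Table 1 (`Ĩ⁽²⁾ = 0.6468`).
* [KLS1988PRL] T. Kennedy, E. H. Lieb, B. S. Shastry, Phys. Rev. Lett. 61 (1988) 2582–2584, eq. (8)
  (`I(2) = 0.65`).
-/

noncomputable section

open MeasureTheory Set Filter Topology
open scoped ENNReal
open Literature.MathematicalPhysics.QuantumLattice Literature.Probability.LatticeModels

namespace Literature.MathematicalPhysics.QuantumLattice

/-! ### The convexity step and the sharper pointwise majorant -/

section Pointwise

/-- **The chord of `X ↦ X^{-1/2}`**: for `a, b > 0` and weights `w₁, w₂ ≥ 0`, `w₁ + w₂ = 1`,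
`1/√(w₁a² + w₂b²) ≤ w₁/a + w₂/b` (`(w₁/a + w₂/b)(w₁a + w₂b) ≥ 1` and `(w₁a + w₂b)² ≤ w₁a² + w₂b²`,
both equal to `w₁w₂(a-b)² ≥ 0` after clearing denominators). [folklore] -/
theorem inv_sqrt_convexComb_le {a b w₁ w₂ : ℝ} (ha : 0 < a) (hb : 0 < b) (h₁ : 0 ≤ w₁) (h₂ : 0 ≤ w₂)
    (hw : w₁ + w₂ = 1) :
    (Real.sqrt (w₁ * a ^ 2 + w₂ * b ^ 2))⁻¹ ≤ w₁ / a + w₂ / b := by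
  obtain rfl : w₂ = 1 - w₁ := by linarith
  have hm : 0 < w₁ * a + (1 - w₁) * b := by
    rcases h₁.eq_or_lt with h | h
    · rw [← h]; simpa using hb
    · exact add_pos_of_pos_of_nonneg (mul_pos h ha) (mul_nonneg h₂ hb.le)
  have hkey : 0 ≤ w₁ * (1 - w₁) * (a - b) ^ 2 := mul_nonneg (mul_nonneg h₁ h₂) (sq_nonneg (a - b))
  -- `(w₁a + w₂b)² ≤ w₁a² + w₂b²`
  have hsq : (w₁ * a + (1 - w₁) * b) ^ 2 ≤ w₁ * a ^ 2 + (1 - w₁) * b ^ 2 := by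
    have : w₁ * a ^ 2 + (1 - w₁) * b ^ 2 - (w₁ * a + (1 - w₁) * b) ^ 2 =
        w₁ * (1 - w₁) * (a - b) ^ 2 := by ring
    linarith
  have hsqrt : w₁ * a + (1 - w₁) * b ≤ Real.sqrt (w₁ * a ^ 2 + (1 - w₁) * b ^ 2) :=
    Real.le_sqrt_of_sq_le hsq
  have hspos : 0 < Real.sqrt (w₁ * a ^ 2 + (1 - w₁) * b ^ 2) := hm.trans_le hsqrt
  -- `(w₁/a + w₂/b)(w₁a + w₂b) ≥ 1`
  have hR : 1 ≤ (w₁ / a + (1 - w₁) / b) * (w₁ * a + (1 - w₁) * b) := by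
    rw [div_add_div _ _ ha.ne' hb.ne', div_mul_eq_mul_div, le_div_iff₀ (mul_pos ha hb)]
    have : (w₁ * b + a * (1 - w₁)) * (w₁ * a + (1 - w₁) * b) - 1 * (a * b) =
        w₁ * (1 - w₁) * (a - b) ^ 2 := by ring
    linarith
  have hRpos : 0 ≤ w₁ / a + (1 - w₁) / b := add_nonneg (div_nonneg h₁ ha.le) (div_nonneg h₂ hb.le)
  rw [inv_le_iff_one_le_mul₀ hspos]
  calc (1 : ℝ) ≤ (w₁ / a + (1 - w₁) / b) * (w₁ * a + (1 - w₁) * b) := hR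
    _ ≤ (w₁ / a + (1 - w₁) / b) * Real.sqrt (w₁ * a ^ 2 + (1 - w₁) * b ^ 2) :=
        mul_le_mul_of_nonneg_left hsqrt hRpos

/-- **The sharper pointwise majorant.** For `0 < s² + t² = r² < 1` and `y = 1 - s² - t²`,
`4y√((1+y)/(1-y)) / (√(1-s²)√(1-t²)) ≤ 4(1-r²)√(2-r²)/√(r²) · (w₁/√(1-r²) + w₂/(1-r²/2))`,
`w₂ = 4s²t²/r⁴`, `w₁ = 1 - w₂`: the left side is `4(1-r²)√((2-r²)/r²)/√((1-s²)(1-t²))` and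
`(1-s²)(1-t²) = w₁(1-r²) + w₂(1-r²/2)²` (`inv_sqrt_convexComb_le`).
[Björnberg–Ueltschi 2022, the value `Ĩ⁽²⁾ = 0.6468` of Table 1 (here: an analytic majorant)]
[folklore] -/
theorem kls_substituted_integrand_le_sharp {s t : ℝ} (h0 : 0 < s ^ 2 + t ^ 2)
    (h1 : s ^ 2 + t ^ 2 < 1) :
    4 * ((1 - s ^ 2 - t ^ 2) * Real.sqrt ((1 + (1 - s ^ 2 - t ^ 2)) / (1 - (1 - s ^ 2 - t ^ 2)))) /
        (Real.sqrt (1 - s ^ 2) * Real.sqrt (1 - t ^ 2)) ≤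
      4 * (1 - (s ^ 2 + t ^ 2)) * Real.sqrt (2 - (s ^ 2 + t ^ 2)) / Real.sqrt (s ^ 2 + t ^ 2) *
        ((1 - 4 * (s ^ 2 * t ^ 2) / (s ^ 2 + t ^ 2) ^ 2) / Real.sqrt (1 - (s ^ 2 + t ^ 2)) +
          (4 * (s ^ 2 * t ^ 2) / (s ^ 2 + t ^ 2) ^ 2) / (1 - (s ^ 2 + t ^ 2) / 2)) := by
  set u := s ^ 2 + t ^ 2 with hu
  set w₂ : ℝ := 4 * (s ^ 2 * t ^ 2) / u ^ 2 with hw₂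
  have hs2 : s ^ 2 < 1 := by nlinarith [sq_nonneg t]
  have ht2 : t ^ 2 < 1 := by nlinarith [sq_nonneg s]
  have hw₂0 : 0 ≤ w₂ := by positivity
  have hw₂1 : w₂ ≤ 1 := by
    rw [hw₂, div_le_one (by positivity), hu]
    nlinarith [sq_nonneg (s ^ 2 - t ^ 2)]
  have hw₁0 : 0 ≤ 1 - w₂ := sub_nonneg.2 hw₂1
  have ha : 0 < Real.sqrt (1 - u) := Real.sqrt_pos.2 (by linarith)
  have hb : 0 < 1 - u / 2 := by linarith
  -- the product under the root is the convex combination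
  have hX : (1 - w₂) * Real.sqrt (1 - u) ^ 2 + w₂ * (1 - u / 2) ^ 2 = (1 - s ^ 2) * (1 - t ^ 2) := by
    rw [Real.sq_sqrt (by linarith)]
    have hu0 : u ≠ 0 := h0.ne'
    have key : w₂ * u ^ 2 = 4 * (s ^ 2 * t ^ 2) := by
      rw [hw₂]; field_simp
    have : (1 - w₂) * (1 - u) + w₂ * (1 - u / 2) ^ 2 = (1 - u) + w₂ * u ^ 2 / 4 := by ring
    rw [this, key, hu]
    ring
  have hconv := inv_sqrt_convexComb_le ha hb hw₁0 hw₂0 (by ring)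
  rw [hX, Real.sqrt_mul (by linarith)] at hconv
  -- the left side is `C / (√(1-s²)√(1-t²))` with `C = 4(1-u)√((2-u)/u) = 4(1-u)√(2-u)/√u`
  have hC : 4 * ((1 - s ^ 2 - t ^ 2) *
      Real.sqrt ((1 + (1 - s ^ 2 - t ^ 2)) / (1 - (1 - s ^ 2 - t ^ 2)))) =
      4 * (1 - u) * Real.sqrt (2 - u) / Real.sqrt u := by
    rw [show (1 : ℝ) - s ^ 2 - t ^ 2 = 1 - u by rw [hu]; ring, show (1 : ℝ) + (1 - u) = 2 - u by ring,
      show (1 : ℝ) - (1 - u) = u by ring, Real.sqrt_div' _ h0.le]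
    ring
  have hCpos : 0 ≤ 4 * (1 - u) * Real.sqrt (2 - u) / Real.sqrt u := by
    have : 0 ≤ 1 - u := by linarith
    positivity
  rw [hC, div_eq_mul_inv]
  exact mul_le_mul_of_nonneg_left hconv hCpos

/-- `√(2 - r²) ≤ √2 (1 - r²/4)` (the tangent of the concave square root: squaring,
`2 - r² ≤ 2(1 - r²/4)² = 2 - r² + r⁴/8`). [folklore] -/
theorem sqrt_two_sub_sq_le (r : ℝ) (hr : r ^ 2 ≤ 1) :
    Real.sqrt (2 - r ^ 2) ≤ Real.sqrt 2 * (1 - r ^ 2 / 4) := by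
  have h4 : 0 ≤ 1 - r ^ 2 / 4 := by nlinarith
  rw [show Real.sqrt 2 * (1 - r ^ 2 / 4) = Real.sqrt (2 * (1 - r ^ 2 / 4) ^ 2) by
    rw [Real.sqrt_mul (by norm_num), Real.sqrt_sq h4]]
  exact Real.sqrt_le_sqrt (by nlinarith [sq_nonneg (r ^ 2)])

end Pointwise

/-! ### The one-dimensional integrals -/

section OneDim

/-- `∫₀¹ √(1 - x²) dx = π/4` (half of Mathlib's `integral_sqrt_one_sub_sq`, by evenness).
[folklore] -/
theorem integral_sqrt_one_sub_sq_unit : ∫ x in (0 : ℝ)..1, Real.sqrt (1 - x ^ 2) = Real.pi / 4 := by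
  have hint : ∀ a b : ℝ, IntervalIntegrable (fun x : ℝ => Real.sqrt (1 - x ^ 2)) volume a b :=
    fun a b => (by fun_prop : Continuous fun x : ℝ => Real.sqrt (1 - x ^ 2)).intervalIntegrable a b
  have hsplit := intervalIntegral.integral_add_adjacent_intervals (hint (-1) 0) (hint 0 1)
  have hneg : ∫ x in (-1 : ℝ)..0, Real.sqrt (1 - x ^ 2) = ∫ x in (0 : ℝ)..1, Real.sqrt (1 - x ^ 2) := by
    have h := intervalIntegral.integral_comp_neg (a := (0 : ℝ)) (b := 1)
      (f := fun x : ℝ => Real.sqrt (1 - x ^ 2))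
    simp only [neg_zero, even_two, Even.neg_pow] at h
    rw [← h]
  rw [hneg, integral_sqrt_one_sub_sq] at hsplit
  linarith

/-- `∫₀¹ √(1 - x²)(1 - 4x²) dx = 0`: `x(1 - x²)√(1 - x²)` is an antiderivative vanishing at both
ends. [folklore] -/
theorem integral_sqrt_one_sub_sq_mul_one_sub_four_sq :
    ∫ x in (0 : ℝ)..1, Real.sqrt (1 - x ^ 2) * (1 - 4 * x ^ 2) = 0 := by
  have hderiv : ∀ x ∈ Ioo (0 : ℝ) 1,
      HasDerivAt (fun x : ℝ => x * (1 - x ^ 2) * Real.sqrt (1 - x ^ 2))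
        (Real.sqrt (1 - x ^ 2) * (1 - 4 * x ^ 2)) x := by
    intro x hx
    have hx1 : 0 < 1 - x ^ 2 := by nlinarith [hx.1, hx.2]
    have h1 : HasDerivAt (fun x : ℝ => 1 - x ^ 2) (-(2 * x)) x := by
      simpa using (hasDerivAt_pow 2 x).const_sub 1
    have h2 : HasDerivAt (fun x : ℝ => Real.sqrt (1 - x ^ 2)) (-(2 * x) / (2 * Real.sqrt (1 - x ^ 2))) x :=
      h1.sqrt hx1.ne'
    have h3 : HasDerivAt (fun x : ℝ => x * (1 - x ^ 2) * Real.sqrt (1 - x ^ 2))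
        ((1 * (1 - x ^ 2) + x * -(2 * x)) * Real.sqrt (1 - x ^ 2) +
          x * (1 - x ^ 2) * (-(2 * x) / (2 * Real.sqrt (1 - x ^ 2)))) x :=
      ((hasDerivAt_id x).mul h1).mul h2
    refine h3.congr_deriv ?_
    set S := Real.sqrt (1 - x ^ 2) with hS
    have hs : S ≠ 0 := (Real.sqrt_pos.2 hx1).ne'
    have hss : S * S = 1 - x ^ 2 := Real.mul_self_sqrt hx1.le
    have hq : (1 - x ^ 2) / S = S := by
      rw [div_eq_iff hs, hss]
    calc (1 * (1 - x ^ 2) + x * -(2 * x)) * S + x * (1 - x ^ 2) * (-(2 * x) / (2 * S))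
        = (1 - 3 * x ^ 2) * S - x ^ 2 * ((1 - x ^ 2) / S) := by
          field_simp
          ring
      _ = S * (1 - 4 * x ^ 2) := by rw [hq]; ring
  have hcont : ContinuousOn (fun x : ℝ => x * (1 - x ^ 2) * Real.sqrt (1 - x ^ 2)) (Icc 0 1) :=
    (by fun_prop : Continuous fun x : ℝ => x * (1 - x ^ 2) * Real.sqrt (1 - x ^ 2)).continuousOn
  have hint : IntervalIntegrable (fun x : ℝ => Real.sqrt (1 - x ^ 2) * (1 - 4 * x ^ 2)) volume 0 1 :=
    (by fun_prop : Continuous fun x : ℝ => Real.sqrt (1 - x ^ 2) * (1 - 4 * x ^ 2)).intervalIntegrable 0 1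
  rw [intervalIntegral.integral_eq_sub_of_hasDerivAt_of_le zero_le_one hcont hderiv hint]
  norm_num

/-- `∫₀¹ √(1 - x²)(1 - x²/4) dx = 15π/64` (`= (15/16)·π/4 + (1/16)·0`). [folklore] -/
theorem integral_sqrt_one_sub_sq_mul :
    ∫ x in (0 : ℝ)..1, Real.sqrt (1 - x ^ 2) * (1 - x ^ 2 / 4) = 15 * Real.pi / 64 := by
  have h : ∀ x : ℝ, Real.sqrt (1 - x ^ 2) * (1 - x ^ 2 / 4) =
      (15 / 16 : ℝ) * Real.sqrt (1 - x ^ 2) + (1 / 16 : ℝ) * (Real.sqrt (1 - x ^ 2) * (1 - 4 * x ^ 2)) :=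
    fun x => by ring
  simp_rw [h]
  have hi1 : IntervalIntegrable (fun x : ℝ => (15 / 16 : ℝ) * Real.sqrt (1 - x ^ 2)) volume 0 1 :=
    (by fun_prop : Continuous fun x : ℝ => (15 / 16 : ℝ) * Real.sqrt (1 - x ^ 2)).intervalIntegrable 0 1
  have hi2 : IntervalIntegrable
      (fun x : ℝ => (1 / 16 : ℝ) * (Real.sqrt (1 - x ^ 2) * (1 - 4 * x ^ 2))) volume 0 1 :=
    (by fun_prop : Continuous fun x : ℝ =>
      (1 / 16 : ℝ) * (Real.sqrt (1 - x ^ 2) * (1 - 4 * x ^ 2))).intervalIntegrable 0 1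
  rw [intervalIntegral.integral_add hi1 hi2, intervalIntegral.integral_const_mul,
    intervalIntegral.integral_const_mul, integral_sqrt_one_sub_sq_unit,
    integral_sqrt_one_sub_sq_mul_one_sub_four_sq]
  ring

/-- `∫₀¹ 8(1 - x²)/√(2 - x²) dx = 4`: `4x√(2 - x²)` is an antiderivative. [folklore] -/
theorem integral_eight_mul_one_sub_sq_div_sqrt :
    ∫ x in (0 : ℝ)..1, 8 * (1 - x ^ 2) / Real.sqrt (2 - x ^ 2) = 4 := by
  have hderiv : ∀ x ∈ Ioo (0 : ℝ) 1,
      HasDerivAt (fun x : ℝ => 4 * x * Real.sqrt (2 - x ^ 2)) (8 * (1 - x ^ 2) / Real.sqrt (2 - x ^ 2)) x := by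
    intro x hx
    have hx1 : 0 < 2 - x ^ 2 := by nlinarith [hx.1, hx.2]
    have h1 : HasDerivAt (fun x : ℝ => 2 - x ^ 2) (-(2 * x)) x := by
      simpa using (hasDerivAt_pow 2 x).const_sub 2
    have h2 : HasDerivAt (fun x : ℝ => Real.sqrt (2 - x ^ 2)) (-(2 * x) / (2 * Real.sqrt (2 - x ^ 2))) x :=
      h1.sqrt hx1.ne'
    have h3 : HasDerivAt (fun x : ℝ => 4 * x * Real.sqrt (2 - x ^ 2))
        (4 * 1 * Real.sqrt (2 - x ^ 2) + 4 * x * (-(2 * x) / (2 * Real.sqrt (2 - x ^ 2)))) x :=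
      ((hasDerivAt_id x).const_mul 4).mul h2
    refine h3.congr_deriv ?_
    set S := Real.sqrt (2 - x ^ 2) with hS
    have hs : S ≠ 0 := (Real.sqrt_pos.2 hx1).ne'
    have hss : S * S = 2 - x ^ 2 := Real.mul_self_sqrt hx1.le
    rw [eq_div_iff hs]
    calc (4 * 1 * S + 4 * x * (-(2 * x) / (2 * S))) * S = 4 * (S * S) - 4 * x ^ 2 := by
          field_simp
          ring
      _ = 8 * (1 - x ^ 2) := by rw [hss]; ring
  have hcont : ContinuousOn (fun x : ℝ => 4 * x * Real.sqrt (2 - x ^ 2)) (Icc 0 1) :=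
    (by fun_prop : Continuous fun x : ℝ => 4 * x * Real.sqrt (2 - x ^ 2)).continuousOn
  have hint : IntervalIntegrable (fun x : ℝ => 8 * (1 - x ^ 2) / Real.sqrt (2 - x ^ 2)) volume 0 1 := by
    refine (ContinuousOn.div (by fun_prop) (by fun_prop) fun x hx => ?_).intervalIntegrable
    rw [uIcc_of_le zero_le_one] at hx
    exact (Real.sqrt_pos.2 (by nlinarith [hx.1, hx.2])).ne'
  rw [intervalIntegral.integral_eq_sub_of_hasDerivAt_of_le zero_le_one hcont hderiv hint]
  norm_num

/-- `∫_{-π}^{π} sin²(2θ) dθ = π`. [folklore] -/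
theorem integral_sin_two_mul_sq :
    ∫ θ in (-Real.pi)..Real.pi, Real.sin (2 * θ) ^ 2 = Real.pi := by
  have h := intervalIntegral.integral_comp_mul_left (a := -Real.pi) (b := Real.pi)
    (fun x => Real.sin x ^ 2) two_ne_zero
  rw [h, integral_sin_sq, show (2 : ℝ) * -Real.pi = -(2 * Real.pi) by ring, Real.sin_neg,
    Real.sin_two_pi]
  simp only [neg_zero, zero_mul, sub_zero, smul_eq_mul]
  ring

/-- `∫_{-π}^{π} cos²(2θ) dθ = π`. [folklore] -/
theorem integral_cos_two_mul_sq :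
    ∫ θ in (-Real.pi)..Real.pi, Real.cos (2 * θ) ^ 2 = Real.pi := by
  have h := intervalIntegral.integral_comp_mul_left (a := -Real.pi) (b := Real.pi)
    (fun x => Real.cos x ^ 2) two_ne_zero
  rw [h, integral_cos_sq, show (2 : ℝ) * -Real.pi = -(2 * Real.pi) by ring, Real.sin_neg,
    Real.sin_two_pi]
  simp only [neg_zero, mul_zero, sub_zero, smul_eq_mul]
  ring

/-- The lower Lebesgue integral of a continuous nonnegative function over `(-π, π)` through the
interval integral. [folklore] -/
theorem lintegral_Ioo_eq_ofReal_intervalIntegral {f : ℝ → ℝ} (hf : Continuous f) (hnn : ∀ x, 0 ≤ f x)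
    {a b : ℝ} (hab : a ≤ b) :
    ∫⁻ x in Ioo a b, ENNReal.ofReal (f x) = ENNReal.ofReal (∫ x in a..b, f x) := by
  have hint : IntegrableOn f (Ioo a b) := (hf.integrableOn_Icc).mono_set Ioo_subset_Icc_self
  rw [← ofReal_integral_eq_lintegral_ofReal hint (Eventually.of_forall fun x => hnn x),
    ← integral_Ioc_eq_integral_Ioo, ← intervalIntegral.integral_of_le hab]

end OneDim

/-! ### The sharper bound on the two-dimensional integral -/

section Integral

/-- **The substituted integral is at most `15√2π²/16 + 4π`**:
`∫_{[-π,π]²} F₂ ≤ 15√2π²/16 + 4π` (as a Lebesgue integral), i.e. `I(2) = Ĩ⁽²⁾ ≤ 15√2/64 + 1/π =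
0.64976…`. Same route as the tree's `lintegral_klsIntegrand_two_le` (half-angle substitution,
change of variables, polar coordinates), with the sharper angular-dependent majorant
`kls_substituted_integrand_le_sharp`, the angular integrals `∫ cos²2φ = ∫ sin²2φ = π`, and the
radial integrals `∫₀¹ 4√((1-r²)(2-r²)) ≤ 15√2π/16`, `∫₀¹ 8(1-r²)/√(2-r²) = 4`.
[Björnberg–Ueltschi 2022, Table 1 (`Ĩ⁽²⁾ = 0.6468`); Kennedy–Lieb–Shastry 1988, `I(2) = 0.65`]
[folklore] -/
theorem lintegral_klsIntegrand_two_le_sharp :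
    ∫⁻ p in Set.pi univ (fun _ : Fin 2 => Icc (-Real.pi) Real.pi), ENNReal.ofReal (klsIntegrand 2 p)
      ≤ ENNReal.ofReal (15 * Real.sqrt 2 * Real.pi ^ 2 / 16 + 4 * Real.pi) := by
  -- (a) closed box → open box
  have hae : (Set.pi univ fun _ : Fin 2 => Ioo (-Real.pi) Real.pi) =ᵐ[volume]
      (Set.pi univ fun _ : Fin 2 => Icc (-Real.pi) Real.pi) := by
    have h := Measure.pi_Ioo_ae_eq_pi_Icc (μ := fun _ : Fin 2 => (volume : Measure ℝ)) (s := univ)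
      (f := fun _ => -Real.pi) (g := fun _ => Real.pi)
    rw [← volume_pi] at h
    exact h
  rw [← setLIntegral_congr hae]
  -- (b) transport to `ℝ × ℝ`
  set S₂ : Set (ℝ × ℝ) := Ioo (-Real.pi) Real.pi ×ˢ Ioo (-Real.pi) Real.pi with hS₂
  have hS₂m : MeasurableSet S₂ := measurableSet_Ioo.prod measurableSet_Ioo
  set Φ : ℝ × ℝ → ℝ≥0∞ := fun q => ENNReal.ofReal (klsIntegrand 2 ![q.1, q.2]) with hΦ
  have hpre : (MeasurableEquiv.finTwoArrow : (Fin 2 → ℝ) ≃ᵐ ℝ × ℝ) ⁻¹' S₂ =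
      Set.pi univ fun _ : Fin 2 => Ioo (-Real.pi) Real.pi := by
    ext v
    simp [hS₂, MeasurableEquiv.finTwoArrow_apply, Fin.forall_fin_two]
  have hb : ∫⁻ v in Set.pi univ (fun _ : Fin 2 => Ioo (-Real.pi) Real.pi),
      ENNReal.ofReal (klsIntegrand 2 v) = ∫⁻ q in S₂, Φ q := by
    rw [← hpre, ← (volume_preserving_finTwoArrow ℝ).setLIntegral_comp_preimage_emb
      (MeasurableEquiv.finTwoArrow).measurableEmbedding Φ S₂]
    refine lintegral_congr fun v => ?_
    simp only [hΦ, MeasurableEquiv.finTwoArrow_apply]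
    congr 2
    ext i
    fin_cases i <;> rfl
  rw [hb]
  -- (c) change of variables on `S₂`
  set ψ : ℝ × ℝ → ℝ × ℝ := fun q => (Real.sin (q.1 / 2), Real.sin (q.2 / 2)) with hψ
  set ψ' : ℝ × ℝ → (ℝ × ℝ →L[ℝ] ℝ × ℝ) := fun q =>
    (ContinuousLinearMap.toSpanSingleton ℝ (Real.cos (q.1 / 2) / 2)).prodMap
      (ContinuousLinearMap.toSpanSingleton ℝ (Real.cos (q.2 / 2) / 2)) with hψ'
  have hderiv : ∀ q ∈ S₂, HasFDerivWithinAt ψ (ψ' q) S₂ q := fun q _ =>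
    (HasFDerivAt.prodMap (p := q) (hasDerivAt_sin_half q.1).hasFDerivAt
      (hasDerivAt_sin_half q.2).hasFDerivAt).hasFDerivWithinAt
  have hinj : InjOn ψ S₂ := injOn_sin_half.prodMap injOn_sin_half
  set g : ℝ × ℝ → ℝ≥0∞ := fun w => ENNReal.ofReal (4 * (max (1 - w.1 ^ 2 - w.2 ^ 2) 0 *
    Real.sqrt ((1 + (1 - w.1 ^ 2 - w.2 ^ 2)) / (1 - (1 - w.1 ^ 2 - w.2 ^ 2)))) /
      (Real.sqrt (1 - w.1 ^ 2) * Real.sqrt (1 - w.2 ^ 2))) with hg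
  have hpt : EqOn Φ (fun q => ENNReal.ofReal |(ψ' q).det| * g (ψ q)) S₂ := by
    rintro ⟨a, b⟩ ⟨ha, hb⟩
    have hca : 0 < Real.cos (a / 2) := Real.cos_pos_of_mem_Ioo ⟨by linarith [ha.1], by linarith [ha.2]⟩
    have hcb : 0 < Real.cos (b / 2) := Real.cos_pos_of_mem_Ioo ⟨by linarith [hb.1], by linarith [hb.2]⟩
    have hsa : Real.sqrt (1 - Real.sin (a / 2) ^ 2) = Real.cos (a / 2) :=
      (Real.cos_eq_sqrt_one_sub_sin_sq (by linarith [ha.1]) (by linarith [ha.2])).symm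
    have hsb : Real.sqrt (1 - Real.sin (b / 2) ^ 2) = Real.cos (b / 2) :=
      (Real.cos_eq_sqrt_one_sub_sin_sq (by linarith [hb.1]) (by linarith [hb.2])).symm
    simp only [hΦ, hg, hψ, hψ', det_toSpanSingleton_prodMap]
    rw [klsIntegrand_two, half_cos_add_cos_eq, hsa, hsb,
      abs_of_pos (mul_pos (half_pos hca) (half_pos hcb)), ← ENNReal.ofReal_mul (by positivity)]
    congr 1
    field_simp
    ring
  have hc : ∫⁻ q in S₂, Φ q = ∫⁻ w in ψ '' S₂, g w := by
    rw [lintegral_image_eq_lintegral_abs_det_fderiv_mul volume hS₂m hderiv hinj g]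
    exact setLIntegral_congr_fun hS₂m hpt
  rw [hc]
  refine (setLIntegral_le_lintegral _ _).trans ?_
  -- (d) the sharper majorant
  set h : ℝ × ℝ → ℝ≥0∞ := fun w => ENNReal.ofReal (if 0 < w.1 ^ 2 + w.2 ^ 2 ∧ w.1 ^ 2 + w.2 ^ 2 < 1 then
    4 * (1 - (w.1 ^ 2 + w.2 ^ 2)) * Real.sqrt (2 - (w.1 ^ 2 + w.2 ^ 2)) / Real.sqrt (w.1 ^ 2 + w.2 ^ 2) *
      ((1 - 4 * (w.1 ^ 2 * w.2 ^ 2) / (w.1 ^ 2 + w.2 ^ 2) ^ 2) / Real.sqrt (1 - (w.1 ^ 2 + w.2 ^ 2)) +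
        (4 * (w.1 ^ 2 * w.2 ^ 2) / (w.1 ^ 2 + w.2 ^ 2) ^ 2) / (1 - (w.1 ^ 2 + w.2 ^ 2) / 2))
    else 0) with hh
  have hgh : g ≤ h := by
    rintro ⟨s, t⟩
    simp only [hg, hh]
    by_cases hlt : s ^ 2 + t ^ 2 < 1
    · rcases (show 0 ≤ s ^ 2 + t ^ 2 by positivity).eq_or_lt with h0 | h0
      · -- the origin: both sides are (junk) `0`
        have hs : s = 0 := by nlinarith [sq_nonneg s, sq_nonneg t]
        have ht : t = 0 := by nlinarith [sq_nonneg s, sq_nonneg t]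
        subst hs; subst ht
        norm_num
      · rw [if_pos ⟨h0, hlt⟩, max_eq_left (by linarith)]
        exact ENNReal.ofReal_le_ofReal (kls_substituted_integrand_le_sharp h0 hlt)
    · rw [max_eq_right (by linarith), if_neg (fun h' => hlt h'.2), ENNReal.ofReal_zero]
      simp
  refine (lintegral_mono hgh).trans ?_
  -- (e) polar coordinates: `r • h = φ₁(r) cos²(2θ) + φ₂(r) sin²(2θ)` on `0 < r < 1`
  rw [← lintegral_comp_polarCoord_symm h]
  set φ₁ : ℝ → ℝ≥0∞ := fun r => ENNReal.ofReal
    (4 * (1 - r ^ 2) * Real.sqrt (2 - r ^ 2) / Real.sqrt (1 - r ^ 2)) with hφ₁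
  set φ₂ : ℝ → ℝ≥0∞ := fun r => ENNReal.ofReal
    (4 * (1 - r ^ 2) * Real.sqrt (2 - r ^ 2) / (1 - r ^ 2 / 2)) with hφ₂
  set Θ₁ : ℝ → ℝ≥0∞ := fun θ => ENNReal.ofReal (Real.cos (2 * θ) ^ 2) with hΘ₁
  set Θ₂ : ℝ → ℝ≥0∞ := fun θ => ENNReal.ofReal (Real.sin (2 * θ) ^ 2) with hΘ₂
  have hpolar : EqOn (fun p : ℝ × ℝ => ENNReal.ofReal p.1 • h (polarCoord.symm p))
      (fun p => (Ioo (0 : ℝ) 1).indicator φ₁ p.1 * Θ₁ p.2 + (Ioo (0 : ℝ) 1).indicator φ₂ p.1 * Θ₂ p.2)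
      polarCoord.target := by
    rintro ⟨r, θ⟩ ⟨hr, -⟩
    simp only [Set.mem_Ioi] at hr
    have hr2 : (r * Real.cos θ) ^ 2 + (r * Real.sin θ) ^ 2 = r ^ 2 := by
      nlinarith [Real.sin_sq_add_cos_sq θ]
    simp only [hh, polarCoord_symm_apply, hr2, smul_eq_mul]
    by_cases h1 : r < 1
    · have hr01 : r ∈ Set.Ioo (0 : ℝ) 1 := ⟨hr, h1⟩
      have hrr : 0 < r ^ 2 := by positivity
      rw [if_pos ⟨hrr, by nlinarith⟩, Set.indicator_of_mem hr01, Set.indicator_of_mem hr01]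
      simp only [hφ₁, hφ₂, hΘ₁, hΘ₂]
      -- the weights are `cos²(2θ)`, `sin²(2θ)`
      have hw : 4 * ((r * Real.cos θ) ^ 2 * (r * Real.sin θ) ^ 2) / (r ^ 2) ^ 2 = Real.sin (2 * θ) ^ 2 := by
        rw [Real.sin_two_mul]
        field_simp
        ring
      have hw' : 1 - Real.sin (2 * θ) ^ 2 = Real.cos (2 * θ) ^ 2 := by
        nlinarith [Real.sin_sq_add_cos_sq (2 * θ)]
      rw [hw, hw', Real.sqrt_sq hr.le]
      have hA : 0 ≤ 4 * (1 - r ^ 2) * Real.sqrt (2 - r ^ 2) := by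
        have : 0 ≤ 1 - r ^ 2 := by nlinarith
        positivity
      have hs1 : 0 ≤ Real.sqrt (1 - r ^ 2) := Real.sqrt_nonneg _
      have hb2 : 0 < 1 - r ^ 2 / 2 := by nlinarith
      have e1 : ENNReal.ofReal (4 * (1 - r ^ 2) * Real.sqrt (2 - r ^ 2) / Real.sqrt (1 - r ^ 2)) *
          ENNReal.ofReal (Real.cos (2 * θ) ^ 2) =
          ENNReal.ofReal (4 * (1 - r ^ 2) * Real.sqrt (2 - r ^ 2) / Real.sqrt (1 - r ^ 2) *
            Real.cos (2 * θ) ^ 2) := (ENNReal.ofReal_mul (by positivity)).symm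
      have e2 : ENNReal.ofReal (4 * (1 - r ^ 2) * Real.sqrt (2 - r ^ 2) / (1 - r ^ 2 / 2)) *
          ENNReal.ofReal (Real.sin (2 * θ) ^ 2) =
          ENNReal.ofReal (4 * (1 - r ^ 2) * Real.sqrt (2 - r ^ 2) / (1 - r ^ 2 / 2) *
            Real.sin (2 * θ) ^ 2) := (ENNReal.ofReal_mul (by positivity)).symm
      rw [e1, e2, ← ENNReal.ofReal_add (by positivity) (by positivity)]
      try rw [← ENNReal.ofReal_mul hr.le]
      congr 1
      field_simp
    · rw [if_neg (fun h' => h1 (by nlinarith [h'.2])), Set.indicator_of_notMem (show r ∉ Set.Ioo (0 : ℝ) 1 from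
        fun h => h1 h.2), Set.indicator_of_notMem (show r ∉ Set.Ioo (0 : ℝ) 1 from fun h => h1 h.2),
        ENNReal.ofReal_zero, mul_zero, zero_mul, zero_mul, add_zero]
  rw [setLIntegral_congr_fun polarCoord.open_target.measurableSet hpolar]
  -- (f) the product integrals
  have hφ₁m : Measurable φ₁ := by rw [hφ₁]; exact ENNReal.measurable_ofReal.comp (by fun_prop)
  have hφ₂m : Measurable φ₂ := by rw [hφ₂]; exact ENNReal.measurable_ofReal.comp (by fun_prop)
  have hΘ₁m : Measurable Θ₁ := by rw [hΘ₁]; exact ENNReal.measurable_ofReal.comp (by fun_prop)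
  have hΘ₂m : Measurable Θ₂ := by rw [hΘ₂]; exact ENNReal.measurable_ofReal.comp (by fun_prop)
  have hF₁m : Measurable fun p : ℝ × ℝ => (Ioo (0 : ℝ) 1).indicator φ₁ p.1 * Θ₁ p.2 :=
    ((hφ₁m.indicator measurableSet_Ioo).comp measurable_fst).mul (hΘ₁m.comp measurable_snd)
  rw [show polarCoord.target = Ioi (0 : ℝ) ×ˢ Ioo (-Real.pi) Real.pi from rfl,
    Measure.volume_eq_prod, ← Measure.prod_restrict, lintegral_add_left hF₁m,
    lintegral_prod_mul ((hφ₁m.indicator measurableSet_Ioo).aemeasurable) hΘ₁m.aemeasurable,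
    lintegral_prod_mul ((hφ₂m.indicator measurableSet_Ioo).aemeasurable) hΘ₂m.aemeasurable,
    lintegral_indicator measurableSet_Ioo, lintegral_indicator measurableSet_Ioo,
    Measure.restrict_restrict measurableSet_Ioo, Set.inter_eq_left.2 Set.Ioo_subset_Ioi_self]
  -- the angular integrals
  have hΘ₁i : ∫⁻ θ in Ioo (-Real.pi) Real.pi, Θ₁ θ = ENNReal.ofReal Real.pi := by
    rw [hΘ₁, lintegral_Ioo_eq_ofReal_intervalIntegral (by fun_prop) (fun x => sq_nonneg _)
      (by linarith [Real.pi_pos]), integral_cos_two_mul_sq]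
  have hΘ₂i : ∫⁻ θ in Ioo (-Real.pi) Real.pi, Θ₂ θ = ENNReal.ofReal Real.pi := by
    rw [hΘ₂, lintegral_Ioo_eq_ofReal_intervalIntegral (by fun_prop) (fun x => sq_nonneg _)
      (by linarith [Real.pi_pos]), integral_sin_two_mul_sq]
  -- the radial integrals
  have hrad₁ : ∫⁻ r in Ioo (0 : ℝ) 1, φ₁ r ≤ ENNReal.ofReal (15 * Real.sqrt 2 * Real.pi / 16) := by
    -- `φ₁ = 4√(1-r²)√(2-r²) ≤ 4√2 √(1-r²)(1 - r²/4)` on `(0,1)`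
    have hle : ∀ r ∈ Ioo (0 : ℝ) 1, φ₁ r ≤
        ENNReal.ofReal (4 * Real.sqrt 2 * (Real.sqrt (1 - r ^ 2) * (1 - r ^ 2 / 4))) := by
      intro r hr
      have hr1 : 0 < 1 - r ^ 2 := by nlinarith [hr.1, hr.2]
      have hs : Real.sqrt (1 - r ^ 2) ≠ 0 := (Real.sqrt_pos.2 hr1).ne'
      have hq : (1 - r ^ 2) / Real.sqrt (1 - r ^ 2) = Real.sqrt (1 - r ^ 2) := by
        rw [div_eq_iff hs, Real.mul_self_sqrt hr1.le]
      rw [hφ₁]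
      refine ENNReal.ofReal_le_ofReal ?_
      have h2 := sqrt_two_sub_sq_le r (by nlinarith [hr.1, hr.2])
      have hs0 : 0 ≤ Real.sqrt (1 - r ^ 2) := Real.sqrt_nonneg _
      calc 4 * (1 - r ^ 2) * Real.sqrt (2 - r ^ 2) / Real.sqrt (1 - r ^ 2)
          = 4 * ((1 - r ^ 2) / Real.sqrt (1 - r ^ 2)) * Real.sqrt (2 - r ^ 2) := by ring
        _ = 4 * Real.sqrt (1 - r ^ 2) * Real.sqrt (2 - r ^ 2) := by rw [hq]
        _ ≤ 4 * Real.sqrt (1 - r ^ 2) * (Real.sqrt 2 * (1 - r ^ 2 / 4)) := by gcongr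
        _ = 4 * Real.sqrt 2 * (Real.sqrt (1 - r ^ 2) * (1 - r ^ 2 / 4)) := by ring
    have hcont : Continuous fun r : ℝ => 4 * Real.sqrt 2 * (Real.sqrt (1 - r ^ 2) * (1 - r ^ 2 / 4)) := by
      fun_prop
    calc ∫⁻ r in Ioo (0 : ℝ) 1, φ₁ r
        ≤ ∫⁻ r in Ioo (0 : ℝ) 1, ENNReal.ofReal (4 * Real.sqrt 2 * (Real.sqrt (1 - r ^ 2) * (1 - r ^ 2 / 4))) :=
          setLIntegral_mono (ENNReal.measurable_ofReal.comp hcont.measurable) hle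
      _ = ENNReal.ofReal (∫ r in (0 : ℝ)..1, 4 * Real.sqrt 2 * (Real.sqrt (1 - r ^ 2) * (1 - r ^ 2 / 4))) :=
          lintegral_Ioo_eq_ofReal_intervalIntegral hcont (fun r => by
            by_cases hr : r ^ 2 ≤ 1
            · exact mul_nonneg (by positivity) (mul_nonneg (Real.sqrt_nonneg _) (by nlinarith))
            · have h0 : Real.sqrt (1 - r ^ 2) = 0 := Real.sqrt_eq_zero'.2 (by linarith [not_le.1 hr])
              rw [h0, zero_mul, mul_zero]) zero_le_one
      _ = ENNReal.ofReal (15 * Real.sqrt 2 * Real.pi / 16) := by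
          rw [intervalIntegral.integral_const_mul, integral_sqrt_one_sub_sq_mul]
          congr 1
          ring
  have hrad₂ : ∫⁻ r in Ioo (0 : ℝ) 1, φ₂ r = ENNReal.ofReal 4 := by
    have hcont : ContinuousOn (fun r : ℝ => 8 * (1 - r ^ 2) / Real.sqrt (2 - r ^ 2)) (Icc 0 1) := by
      refine ContinuousOn.div (by fun_prop) (by fun_prop) fun x hx => ?_
      exact (Real.sqrt_pos.2 (by nlinarith [hx.1, hx.2])).ne'
    have heq : ∀ r ∈ Ioo (0 : ℝ) 1, φ₂ r = ENNReal.ofReal (8 * (1 - r ^ 2) / Real.sqrt (2 - r ^ 2)) := by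
      intro r hr
      have hr2 : 0 < 2 - r ^ 2 := by nlinarith [hr.1, hr.2]
      have hss : Real.sqrt (2 - r ^ 2) * Real.sqrt (2 - r ^ 2) = 2 - r ^ 2 := Real.mul_self_sqrt hr2.le
      have hs : Real.sqrt (2 - r ^ 2) ≠ 0 := (Real.sqrt_pos.2 hr2).ne'
      have hb : (1 - r ^ 2 / 2) ≠ 0 := by nlinarith [hr.1, hr.2]
      simp only [hφ₂]
      congr 1
      rw [div_eq_div_iff hb hs]
      nlinarith [hss]
    have hint : IntegrableOn (fun r : ℝ => 8 * (1 - r ^ 2) / Real.sqrt (2 - r ^ 2)) (Ioo 0 1) :=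
      (hcont.integrableOn_Icc).mono_set Ioo_subset_Icc_self
    have hnn : 0 ≤ᵐ[volume.restrict (Ioo (0 : ℝ) 1)] fun r : ℝ => 8 * (1 - r ^ 2) / Real.sqrt (2 - r ^ 2) := by
      refine (ae_restrict_iff' measurableSet_Ioo).2 (Eventually.of_forall fun r hr => ?_)
      have : 0 ≤ 1 - r ^ 2 := by nlinarith [hr.1, hr.2]
      positivity
    rw [setLIntegral_congr_fun measurableSet_Ioo heq, ← ofReal_integral_eq_lintegral_ofReal hint hnn,
      ← integral_Ioc_eq_integral_Ioo, ← intervalIntegral.integral_of_le zero_le_one,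
      integral_eight_mul_one_sub_sq_div_sqrt]
  -- assembly
  rw [hΘ₁i, hΘ₂i, hrad₂]
  calc (∫⁻ r in Ioo (0 : ℝ) 1, φ₁ r) * ENNReal.ofReal Real.pi + ENNReal.ofReal 4 * ENNReal.ofReal Real.pi
      ≤ ENNReal.ofReal (15 * Real.sqrt 2 * Real.pi / 16) * ENNReal.ofReal Real.pi +
          ENNReal.ofReal 4 * ENNReal.ofReal Real.pi := by gcongr
    _ = ENNReal.ofReal (15 * Real.sqrt 2 * Real.pi ^ 2 / 16 + 4 * Real.pi) := by
        rw [← ENNReal.ofReal_mul (by positivity), ← ENNReal.ofReal_mul (by positivity),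
          ← ENNReal.ofReal_add (by positivity) (by positivity)]
        congr 1
        ring

/-- The numerical value of the sharper bound: `15√2/64 + 1/π < 0.64978` (`= 0.649766…`).
[folklore] -/
theorem kls_sharp_const_lt : 15 * Real.sqrt 2 / 64 + 1 / Real.pi < 0.64978 := by
  have hsqrt2 : Real.sqrt 2 < 1.41422 := by
    rw [Real.sqrt_lt' (by norm_num)]
    norm_num
  have hpi : 1 / Real.pi < 0.31831 := by
    rw [div_lt_iff₀ Real.pi_pos]
    nlinarith [Real.pi_gt_d6]
  linarith

end Integral

/-! ### The punctured Riemann sums in dimension two -/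

section RiemannSum

open Finset

variable {d : ℕ}

/-- **The two-dimensional cell bound, sharpened.** For every side `L ≥ 1`,
`Σ_{a, b ∈ ℤ_L ∖ 0} F₂(2πa/L, 2πb/L) ≤ (L/2π)² ∫_{[-π,π]²} F₂ ≤ (15√2/64 + 1/π) L²`: the tree's
monotone-cell comparison (`kls_cell_spec`, `kls_cell_disjoint`: each term times the cell area is
below the integral over the cell toward the origin) with `lintegral_klsIntegrand_two_le_sharp`.
[Kennedy–Lieb–Shastry 1988, before eq. (2) ("passing from sums to integrals"); Björnberg–Ueltschi
2022, (3.6)–(3.7)] [folklore] -/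
theorem kls_twoDim_sum_le_sharp (L : ℕ) [NeZero L] :
    ∑ v ∈ (univ : Finset (TorusSite 2 L)).filter (fun v => ∀ i, v i ≠ 0),
        klsIntegrand 2 (latticeMomentum L v) ≤
      (15 * Real.sqrt 2 / 64 + 1 / Real.pi) * (L : ℝ) ^ 2 := by
  have hL : (0 : ℝ) < L := by exact_mod_cast Nat.pos_of_ne_zero (NeZero.ne L)
  set h : ℝ := 2 * Real.pi / L with hh_def
  have hh : 0 < h := by positivity
  set C : ℝ := 15 * Real.sqrt 2 * Real.pi ^ 2 / 16 + 4 * Real.pi with hC_def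
  have hC : 0 ≤ C := by positivity
  set S : Finset (TorusSite 2 L) := (univ : Finset (TorusSite 2 L)).filter (fun v => ∀ i, v i ≠ 0)
    with hS_def
  set cell : TorusSite 2 L → Set (Fin 2 → ℝ) := fun v => Set.pi univ fun i =>
    Set.Ioo (h * ((if 0 < (v i).valMinAbs then (v i).valMinAbs - 1 else (v i).valMinAbs : ℤ) : ℝ))
      (h * (((if 0 < (v i).valMinAbs then (v i).valMinAbs - 1 else (v i).valMinAbs : ℤ) : ℝ) + 1))
    with hcell_def
  have hmemS : ∀ {v}, v ∈ S → ∀ i, v i ≠ 0 := fun hv => (mem_filter.1 hv).2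
  have hmeas : ∀ v, MeasurableSet (cell v) := fun v =>
    MeasurableSet.univ_pi fun i => measurableSet_Ioo
  have hvol : ∀ v, volume (cell v) = ENNReal.ofReal (h ^ 2) := by
    intro v
    have h1 : ∀ i : Fin 2, volume (Set.Ioo
        (h * ((if 0 < (v i).valMinAbs then (v i).valMinAbs - 1 else (v i).valMinAbs : ℤ) : ℝ))
        (h * (((if 0 < (v i).valMinAbs then (v i).valMinAbs - 1 else (v i).valMinAbs : ℤ) : ℝ)
          + 1))) = ENNReal.ofReal h := by
      intro i
      rw [Real.volume_Ioo]
      congr 1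
      ring
    simp only [hcell_def]
    rw [volume_pi_pi, Fin.prod_univ_two, h1, h1, ← ENNReal.ofReal_mul hh.le, sq]
  have hdisj : Set.PairwiseDisjoint (↑S : Set (TorusSite 2 L)) cell := by
    intro v hv w hw hvw
    obtain ⟨i, hi⟩ : ∃ i, v i ≠ w i := Function.ne_iff.1 hvw
    simp only [Function.onFun, hcell_def]
    exact Set.disjoint_univ_pi.2 ⟨i, kls_cell_disjoint (hmemS hv i) (hmemS hw i) hi⟩
  have hsub : (⋃ v ∈ S, cell v) ⊆ Set.pi univ fun _ : Fin 2 => Set.Icc (-Real.pi) Real.pi := by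
    refine Set.iUnion₂_subset fun v hv => Set.pi_mono fun i _ θ hθ => ?_
    exact (kls_cell_spec (hmemS (Finset.mem_coe.1 hv) i) hθ).2.2
  have hpt : ∀ v ∈ S, ∀ θ ∈ cell v, klsIntegrand 2 (latticeMomentum L v) ≤ klsIntegrand 2 θ := by
    intro v hv θ hθ
    have hθ' := Set.mem_univ_pi.1 hθ
    refine klsIntegrand_mono_cos two_ne_zero (fun i => ?_)
      (fun i => (kls_cell_spec (hmemS hv i) (hθ' i)).2.1)
    rw [latticeMomentum_apply]
    exact (kls_cell_spec (hmemS hv i) (hθ' i)).1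
  have hFm : Measurable fun θ : Fin 2 → ℝ => ENNReal.ofReal (klsIntegrand 2 θ) :=
    ENNReal.measurable_ofReal.comp (measurable_klsIntegrand 2)
  -- the comparison, in `ℝ≥0∞`
  have key : ∑ v ∈ S, ENNReal.ofReal (klsIntegrand 2 (latticeMomentum L v) * h ^ 2) ≤
      ENNReal.ofReal C := by
    calc ∑ v ∈ S, ENNReal.ofReal (klsIntegrand 2 (latticeMomentum L v) * h ^ 2)
        = ∑ v ∈ S, ∫⁻ _θ in cell v, ENNReal.ofReal (klsIntegrand 2 (latticeMomentum L v)) := by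
          refine sum_congr rfl fun v _ => ?_
          rw [setLIntegral_const, hvol, ENNReal.ofReal_mul (klsIntegrand_nonneg _ _)]
      _ ≤ ∑ v ∈ S, ∫⁻ θ in cell v, ENNReal.ofReal (klsIntegrand 2 θ) :=
          sum_le_sum fun v hv => setLIntegral_mono hFm fun θ hθ =>
            ENNReal.ofReal_le_ofReal (hpt v hv θ hθ)
      _ = ∫⁻ θ in ⋃ v ∈ S, cell v, ENNReal.ofReal (klsIntegrand 2 θ) :=
          (lintegral_biUnion_finset hdisj (fun v _ => hmeas v) _).symm
      _ ≤ ∫⁻ θ in Set.pi univ (fun _ : Fin 2 => Set.Icc (-Real.pi) Real.pi),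
            ENNReal.ofReal (klsIntegrand 2 θ) := lintegral_mono_set hsub
      _ ≤ ENNReal.ofReal C := lintegral_klsIntegrand_two_le_sharp
  rw [← ENNReal.ofReal_sum_of_nonneg
      (fun v _ => mul_nonneg (klsIntegrand_nonneg _ _) (sq_nonneg _)),
    ENNReal.ofReal_le_ofReal_iff hC, ← sum_mul] at key
  have hh2 : h ^ 2 = 4 * Real.pi ^ 2 / (L : ℝ) ^ 2 := by
    rw [hh_def]; field_simp; ring
  calc ∑ v ∈ S, klsIntegrand 2 (latticeMomentum L v)
      ≤ C / h ^ 2 := by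
        rw [le_div_iff₀ (by positivity)]; exact key
    _ = (15 * Real.sqrt 2 / 64 + 1 / Real.pi) * (L : ℝ) ^ 2 := by
        rw [hh2, hC_def]
        field_simp
        ring

/-- **The punctured Riemann sums in two dimensions, sharpened**: for every side `L ≥ 1`,
`R_L(2) ≤ 15√2/64 + 1/π + 2√2 (1 + log L)/L` (interior points by `kls_twoDim_sum_le_sharp`,
boundary points by the tree's `kls_boundary_sum_le`). [Kennedy–Lieb–Shastry 1988, before eq. (2);
Björnberg–Ueltschi 2022, (3.6)–(3.7): `Ĩ⁽ᵈ⁾_ℓ → Ĩ⁽ᵈ⁾`] [folklore] -/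
theorem klsRiemannSum_two_le_sharp (L : ℕ) [NeZero L] :
    klsRiemannSum 2 L ≤ (15 * Real.sqrt 2 / 64 + 1 / Real.pi) +
      2 * Real.sqrt 2 * (1 + Real.log L) / L := by
  classical
  have hL : (0 : ℝ) < L := by exact_mod_cast Nat.pos_of_ne_zero (NeZero.ne L)
  rw [klsRiemannSum_of_neZero, ← sum_filter_add_sum_filter_not _ (fun k => ∀ i, k i ≠ 0), add_div]
  -- interior: the erased point `0` has a vanishing coordinate, so the filters agree
  have hint : ((univ : Finset (TorusSite 2 L)).erase 0).filter (fun k => ∀ i, k i ≠ 0) =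
      (univ : Finset (TorusSite 2 L)).filter (fun v => ∀ i, v i ≠ 0) := by
    ext k
    simp only [Finset.mem_filter, Finset.mem_erase, Finset.mem_univ, true_and, and_true]
    constructor
    · exact fun hk => hk.2
    · exact fun hk => ⟨fun h0 => hk 0 (by rw [h0]; rfl), hk⟩
  have hI := kls_twoDim_sum_le_sharp L
  have hB := kls_boundary_sum_le 0 L
  rw [hint]
  refine add_le_add ?_ ?_
  · rw [div_le_iff₀ (by positivity)]
    exact hI
  · rw [div_le_div_iff₀ (by positivity) hL]
    have h2 : ((0 + 2 : ℕ) : ℝ) * ((0 + 2 : ℕ) - 1) * Real.sqrt ((0 + 2 : ℕ)) * (1 + Real.log L) *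
        (L : ℝ) ^ (0 + 1) * L = 2 * Real.sqrt 2 * (1 + Real.log L) * (L : ℝ) ^ 2 := by
      push_cast
      ring
    calc (∑ k ∈ ((univ : Finset (TorusSite 2 L)).erase 0).filter (fun k => ¬ ∀ i, k i ≠ 0),
          klsIntegrand 2 (latticeMomentum L k)) * L
        ≤ ((0 + 2 : ℕ) : ℝ) * ((0 + 2 : ℕ) - 1) * Real.sqrt ((0 + 2 : ℕ)) * (1 + Real.log L) *
            (L : ℝ) ^ (0 + 1) * L := mul_le_mul_of_nonneg_right hB hL.le
      _ = 2 * Real.sqrt 2 * (1 + Real.log L) * (L : ℝ) ^ 2 := h2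

/-- **Eventual bound on the two-dimensional Riemann sums**: `R_L(2) ≤ 0.651` for all large `L`
(`15√2/64 + 1/π = 0.64976…` and `(1 + log L)/L → 0`). This is the numerical input of the spin-½
planar case of Björnberg–Ueltschi's Theorem 3.2 in the form consumed by the assembly in
`XYZGroundStateOrderProofs.lean` (which needs `limsup R_L(2) < 0.65388…`).
[Björnberg–Ueltschi 2022, Table 1 (`Ĩ⁽²⁾ = 0.6468`)] [folklore] -/
theorem klsRiemannSum_two_eventually_le :
    ∀ᶠ L : ℕ in atTop, klsRiemannSum 2 L ≤ 651 / 1000 := by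
  set C : ℝ := 2 * Real.sqrt 2 with hC
  have hlim : Tendsto (fun L : ℕ => C * ((1 + Real.log L) / (L : ℝ))) atTop (𝓝 (C * 0)) :=
    tendsto_one_add_log_div_nat.const_mul C
  rw [mul_zero] at hlim
  filter_upwards [hlim.eventually_lt_const (show (0 : ℝ) < 0.00122 by norm_num),
    eventually_ne_atTop 0] with L hL hL0
  haveI : NeZero L := ⟨hL0⟩
  have hR := klsRiemannSum_two_le_sharp L
  have hc := kls_sharp_const_lt
  have : C * ((1 + Real.log L) / (L : ℝ)) = 2 * Real.sqrt 2 * (1 + Real.log L) / L := by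
    rw [hC]; ring
  rw [this] at hL
  linarith

end RiemannSum

end Literature.MathematicalPhysics.QuantumLattice
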